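import Mathlib
import Summits.AnomalousDissipation.AnomalousDissipation.Theses.LimitingAbsorption
import Summits.AnomalousDissipation.AnomalousDissipation.Theorems.LimitingAbsorptionRelaxationBoundsInventoryShift
import Literature.Analysis.FluidPDE.PassiveScalarReleaseExistence
import Literature.Analysis.FluidPDE.PassiveScalarProofs
import Literature.Analysis.FluidPDE.AgeDecouplingWindows
import Literature.Analysis.FluidPDE.CheskidovAssemblyTools
import Literature.Analysis.FluidPDE.TurbWave0
import Summits.AnomalousDissipation.AnomalousDissipation.Theorems.FloorUpgrade.Negative.SpeedLimitTools
import Summits.AnomalousDissipation.AnomalousDissipation.Theorems.FloorUpgrade.Negative.BallisticBound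
import HarnessLib

/-!
# Negative knowledge for the crux `FloorUpgrade` (stmt-AnomalousDissipation-15010), I:
# the FAST relaxing-family class of line `SketchIdeator1` is empty (transport speed limit)

Route `route-AnomalousDissipation-LimitingAbsorption`, crux r4 `…Theses.LimitingAbsorption.FloorUpgrade :=
RelaxingFamily → UniformRelaxationWitness`; supports stmt-AnomalousDissipation-15010 (refuter lane; no route
statement concluded). The lead's line `Cruxes/FloorUpgrade/Lines/SketchIdeator1.lean` closes the crux as
`stub_fastFloorUpgrade (stub_boost hR)`. Here:
* the FAST class = the hypothesis `hfast` of `stub_fastFloorUpgrade` (= conclusion of `stub_boost`), kept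
  VERBATIM inside `fastRelaxingFamily_false` (no named proposition is introduced): `RelaxingFamily`'s
  data/clauses, smooth velocities, eventual Cesàro bound `timeMean (∫‖v_j‖²) T ≤ E`, `1 ≤ C`, `‖∇h‖ ≤ G`,
  `(U_h)`, and FAST: `256 C^{1/3} G² E ≤ γ² ‖h‖²₂`;
* B1 = the lead's stub `stub_ballistic`, proved in Part III (`ballistic_bound`) and used here directly;
* `energy_floor` — TRANSPORT SPEED LIMIT (unconditional): every family of global Leray–Hopf drifts with
  `(U_h)` for a smooth `h ≠ 0`, `‖∇h‖ ≤ G`, eventual mean energy `≤ E` has `7 γ² ‖h‖²₂ ≤ 1440 C^{1/3} G² E`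
  (a necessary condition on every witness of crux r3 `RelaxingFamily`; sharp form in Part IV);
* `fastRelaxingFamily_false` (UNCONDITIONAL): `stub_fastFloorUpgrade` is vacuous and
  `stub_boost ⟺ ¬ RelaxingFamily` — the line closes `FloorUpgrade` only by refuting the route.

Proof of the floor: `L = ‖h‖²₂`, `y = C^{1/6}`, `s₀ = 6y/γ`, `S = 3s₀/2`; release `h` into `v_j(a+·)` at any
phase (`Torus.IsGlobalLerayHopf.exists_release`); at a.e. lag `s ∈ (s₀, S)`, `(U_h)` + Cauchy–Schwarz give
`⟨h, Θ(s)⟩ ≤ L/8` (`y⁶e^{-6y} ≤ 1/64`), B1 + `|v·∇h| ≤ G|v|` + Cauchy–Schwarz in time give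
`7L/8 ≤ 3ν_j s₀√L‖Δh‖₂ + 3G²s₀ ∫ₐ^{a+S}‖v_j‖²`; integrate over phases (`AgeDecoupling.integral_window_le`)
and use the Cesàro bound: `7L/8 ≤ 3ν_j s₀√L‖Δh‖₂ + 180 C^{1/3}G²E/γ²`; let `ν_j → 0`. (Paper-sharp form:
`L(1 - √C e^{-γs/2}) ≤ 2G²E s²` for all `s > 0`, i.e. `γ ≲ (G√E/‖h‖) log(e + C)`.)

## References

* R. J. DiPerna, P.-L. Lions, Invent. Math. 98 (1989), Prop. II.1 (weak scalars). [`DiPernaLions1989`]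
* T. D. Drivas, T. M. Elgindi, G. Iyer, I.-J. Jeong, ARMA 243 (2022), (1.2)–(1.3). [`DEIJ2022`]
-/

noncomputable section

open MeasureTheory Set Filter Function TopologicalSpace Topology
open scoped ENNReal NNReal InnerProductSpace

namespace Summit.AnomalousDissipation.AnomalousDissipation.Theorems.FloorUpgrade.Negative

set_option linter.dupNamespace false -- D-0017: `Summit.<S>.<S>.…` namespace by design

open Literature.Analysis Literature.Analysis.FluidPDE Literature.Analysis.FluidPDE.Torus
open Summit.AnomalousDissipation.AnomalousDissipation.Theses.LimitingAbsorption

/-! ## The theorems -/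

set_option maxHeartbeats 800000 in
/-- **Transport speed limit: the mean-energy floor of a relaxing family.** If a family of global
Leray–Hopf drifts `v_j` (any forces `f_j`), jointly smooth and essentially bounded on bounded time
slabs, relaxes a smooth profile `h ≠ 0` `ν`-uniformly and phase-uniformly with constants `(C, γ)`,
`C ≥ 1` — the clause `(U_h)` of `RelaxingFamily` — and `‖∇h‖ ≤ G`, then every eventual Cesàro bound `E`
of the energies `∫‖v_j‖²` obeys `7 γ² ‖h‖²₂ ≤ 1440 C^{1/3} G² E` (unconditional; B1 is the landed
`ballistic_bound`): relaxation at rate `γ` needs sweeping at speed `≳ γ ‖h‖₂ / (G C^{1/6})`. A necessary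
condition on every witness of the crux `RelaxingFamily` (r3) and the reason the fast class of line
`SketchIdeator1` is empty (`fastRelaxingFamily_false`). [folklore] -/
theorem energy_floor {h : UnitAddTorus (Fin 2) → ℝ}
    (hh : FunctionSpaces.Torus.IsSmooth h) (hh0 : h ≠ 0) {ν : ℕ → ℝ} {f : ℕ → ℝ → UnitAddTorus (Fin 2) → EuclideanSpace ℝ (Fin 2)}
    {v₀ : ℕ → UnitAddTorus (Fin 2) → EuclideanSpace ℝ (Fin 2)} {v : ℕ → ℝ → UnitAddTorus (Fin 2) → EuclideanSpace ℝ (Fin 2)} (hν : ∀ j, 0 < ν j)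
    (hνlim : Tendsto ν atTop (𝓝 0)) (hLH : ∀ j, IsGlobalLerayHopf (ν j) (f j) (v₀ j) (v j))
    (hbd : ∀ j : ℕ, ∀ (T : ℝ), 0 < T →
      MemLp (FunctionSpaces.Torus.stLift (v j)) ⊤ (volume.restrict (Ioo (0 : ℝ) T ×ˢ univ)))
    (hsm : ∀ j, FunctionSpaces.Torus.IsSmoothSpaceTimeOn (Ici (0 : ℝ)) (v j)) {E C γ G : ℝ}
    (hEmean : ∀ j, ∀ᶠ T in atTop, timeMean (fun t => ∫ x, ‖v j t x‖ ^ 2) T ≤ E)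
    (hC1 : 1 ≤ C) (hγ : 0 < γ) (hG : ∀ x, ‖FunctionSpaces.Torus.gradient h x‖ ≤ G)
    (hU : ∀ (j : ℕ) (s : ℝ), 0 ≤ s → ∀ (T : ℝ) (θ : ℝ → UnitAddTorus (Fin 2) → ℝ),
      IsWeakScalarTransportOn T (ν j) (fun t => v j (s + t)) h θ →
        ∀ᵐ t ∂(volume.restrict (Ioo (0 : ℝ) T)),
          scalarL2Sq (θ t) ≤ C * Real.exp (-(γ * t)) * scalarL2Sq h) :
    7 * γ ^ 2 * scalarL2Sq h ≤ 1440 * C ^ ((1 : ℝ) / 3) * G ^ 2 * E := by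
  -- profile constants
  have hL : 0 < scalarL2Sq h := scalarL2Sq_pos_of_ne_zero hh hh0
  set L : ℝ := scalarL2Sq h with hLdef
  have hG0 : 0 ≤ G := (norm_nonneg _).trans (hG 0)
  set Dh : ℝ := Real.sqrt (scalarL2Sq (FunctionSpaces.Torus.laplacian h)) with hDhdef
  have hDh0 : 0 ≤ Dh := Real.sqrt_nonneg _
  have hΔ : scalarL2Sq (FunctionSpaces.Torus.laplacian h) ≤ Dh ^ 2 := by
    rw [hDhdef, Real.sq_sqrt (scalarL2Sq_nonneg _)]
  -- `y = C^{1/6}`, `s₀ = 6y/γ`, `S = 3 s₀ / 2`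
  have hC0 : 0 ≤ C := zero_le_one.trans hC1
  set y : ℝ := C ^ ((1 : ℝ) / 6) with hydef
  have hy1 : 1 ≤ y := Real.one_le_rpow hC1 (by norm_num)
  have hy0 : 0 < y := zero_lt_one.trans_le hy1
  have hy6 : y ^ 6 = C := by
    rw [hydef, ← Real.rpow_natCast, ← Real.rpow_mul hC0]
    norm_num
  have hy2 : y ^ 2 = C ^ ((1 : ℝ) / 3) := by
    rw [hydef, ← Real.rpow_natCast, ← Real.rpow_mul hC0]
    norm_num
  set s₀ : ℝ := 6 * y / γ with hs₀def
  have hs₀ : 0 < s₀ := by positivity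
  have hγs₀ : γ * s₀ = 6 * y := by rw [hs₀def]; field_simp
  set S : ℝ := 3 * s₀ / 2 with hSdef
  have hS0 : 0 < S := by positivity
  have hs₀S : s₀ < S := by rw [hSdef]; linarith
  -- the energies `f j t = ∫ ‖v j t‖²`
  set f : ℕ → ℝ → ℝ := fun j t => ∫ x, ‖v j t x‖ ^ 2 with hfdef
  have hf0 : ∀ j t, 0 ≤ f j t := fun j t => integral_nonneg fun x => sq_nonneg _
  have hfc : ∀ j, ContinuousOn (f j) (Ici 0) := fun j =>
    (hsm j).continuousOn_integral_norm_sq (convex_Ici 0)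
  have hfi : ∀ j T, IntegrableOn (f j) (Ioc 0 T) volume := fun j T =>
    (((hfc j).mono Icc_subset_Ici_self).integrableOn_compact isCompact_Icc).mono_set
      Ioc_subset_Icc_self
  have hfca : ∀ j (a : ℝ), 0 ≤ a → ∀ S', ContinuousOn (fun τ => f j (a + τ)) (Icc 0 S') := by
    intro j a ha S'
    refine (hfc j).comp (continuousOn_const.add continuousOn_id) fun τ hτ => ?_
    exact mem_Ici.2 (by linarith [hτ.1])
  have hvL2 : ∀ j (t : ℝ), 0 ≤ t → MemLp (v j t) 2 volume := fun j t ht =>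
    (hLH j (t + 1) (by linarith)).memLp t ⟨ht, by linarith⟩
  -- `E ≥ 0`
  have hE0 : 0 ≤ E := by
    obtain ⟨T₀, hT₀⟩ := eventually_atTop.1 (hEmean 0)
    have hT : 0 < max T₀ 1 := lt_max_of_lt_right zero_lt_one
    have h1 := hT₀ (max T₀ 1) (le_max_left _ _)
    have h2 : 0 ≤ timeMean (fun t => ∫ x, ‖v 0 t x‖ ^ 2) (max T₀ 1) :=
      mul_nonneg (inv_nonneg.2 hT.le) (intervalIntegral.integral_nonneg hT.le fun t _ => hf0 0 t)
    exact h2.trans h1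
  /- Step A: at every level `j` and every phase `a ≥ 0`,
     `7L/8 ≤ 3 ν_j s₀ √L Dh + 3 G² s₀ ∫_{(0,S)} f_j(a + τ) dτ`. -/
  have stepA : ∀ j (a : ℝ), 0 ≤ a →
      7 * L / 8 ≤ 3 * ν j * s₀ * Real.sqrt L * Dh + 3 * G ^ 2 * s₀ * ∫ τ in Ioo 0 S, f j (a + τ) := by
    intro j a ha
    set T : ℝ := 2 * s₀ with hTdef
    have hT0 : 0 < T := by positivity
    have hST : S < T := by rw [hSdef, hTdef]; linarith
    obtain ⟨Θ, hΘ, -⟩ := (hLH j).exists_release (hν j) hT0 ha (hh.memLp 2)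
    -- (U_h) at phase `a`
    have hUh := hU j a ha T Θ hΘ
    -- B1 at phase `a`
    have hu' : MemLp (FunctionSpaces.Torus.stLift (fun t => v j (a + t))) ⊤
        (volume.restrict (Ioo (0 : ℝ) T ×ˢ univ)) := by
      have := Summit.AnomalousDissipation.AnomalousDissipation.Theorems.LapInventory.memLp_top_stLift_comp_const_add ha (hbd j (a + T) (by linarith))
      rwa [show a + T - a = T by ring] at this
    have hB1 := ballistic_bound (ν j) T Dh (fun t => v j (a + t)) h Θ (hν j) hh hDh0 hΔ hu' hΘ
    have hL2 := hΘ.ae_memLp_two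
    -- pick a lag `s ∈ (s₀, S)` where all three a.e. statements hold
    have hsub : Ioo s₀ S ⊆ Ioo 0 T := Ioo_subset_Ioo hs₀.le hST.le
    have hall : ∀ᵐ s ∂(volume.restrict (Ioo s₀ S)), s ∈ Ioo s₀ S ∧
        (scalarL2Sq (Θ s) ≤ C * Real.exp (-(γ * s)) * L ∧
        (L - ∫ x, h x * Θ s x ≤ 2 * ν j * s * Real.sqrt L * Dh +
          2 * (∫ τ in Ioo (0 : ℝ) s, Real.sqrt (∫ x,
            (⟪v j (a + τ) x, FunctionSpaces.Torus.gradient h x⟫_ℝ) ^ 2)) ^ 2) ∧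
        MemLp (Θ s) 2 volume) := by
      have h3 := ae_restrict_of_ae_restrict_of_subset hsub (hUh.and (hB1.and hL2))
      filter_upwards [ae_restrict_mem measurableSet_Ioo, h3] with s hs h3
      exact ⟨hs, h3⟩
    haveI : (ae ((volume : Measure ℝ).restrict (Ioo s₀ S))).NeBot := by
      rw [ae_neBot, Ne, Measure.restrict_eq_zero, Real.volume_Ioo, ENNReal.ofReal_eq_zero, not_le]
      linarith
    obtain ⟨s, hs, hdec, hbal, hmem⟩ := hall.exists
    have hs0 : 0 < s := hs₀.trans hs.1
    -- decay at lag `s`: `‖Θ(s)‖² ≤ L/64`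
    have hdec' : scalarL2Sq (Θ s) ≤ L / 64 := by
      have h1 : Real.exp (-(γ * s)) ≤ Real.exp (-(γ * s₀)) :=
        Real.exp_le_exp.2 (by nlinarith [hs.1, hγ])
      have h2 : C * Real.exp (-(γ * s₀)) ≤ 1 / 64 := by
        rw [hγs₀, ← hy6]; exact pow_six_mul_exp_le hy1
      calc scalarL2Sq (Θ s) ≤ C * Real.exp (-(γ * s)) * L := hdec
        _ ≤ C * Real.exp (-(γ * s₀)) * L := by gcongr
        _ ≤ 1 / 64 * L := by gcongr
        _ = L / 64 := by ring
    -- Cauchy–Schwarz: `⟨h, Θ(s)⟩ ≤ L/8`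
    have hCS : ∫ x, h x * Θ s x ≤ L / 8 := by
      have h1 : ∫ x, h x * Θ s x ≤ Real.sqrt L * Real.sqrt (scalarL2Sq (Θ s)) :=
        integral_mul_le_sqrt_mul_sqrt_of_memLp (hh.memLp 2) hmem
      have h2 : Real.sqrt (scalarL2Sq (Θ s)) ≤ Real.sqrt L / 8 := by
        have e : Real.sqrt (L / 64) = Real.sqrt L / 8 := by
          rw [Real.sqrt_div hL.le, show (64 : ℝ) = 8 ^ 2 by norm_num, Real.sqrt_sq (by norm_num)]
        rw [← e]
        exact Real.sqrt_le_sqrt hdec'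
      calc ∫ x, h x * Θ s x ≤ Real.sqrt L * Real.sqrt (scalarL2Sq (Θ s)) := h1
        _ ≤ Real.sqrt L * (Real.sqrt L / 8) := by gcongr
        _ = L / 8 := by rw [← mul_div_assoc, Real.mul_self_sqrt hL.le]
    -- the velocity term: `(∫₀ˢ ‖v·∇h‖₂)² ≤ G² S ∫₀^S f_j(a+τ) dτ`
    have hvel : (∫ τ in Ioo (0 : ℝ) s, Real.sqrt (∫ x,
        (⟪v j (a + τ) x, FunctionSpaces.Torus.gradient h x⟫_ℝ) ^ 2)) ^ 2 ≤
        G ^ 2 * S * ∫ τ in Ioo 0 S, f j (a + τ) := by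
      have hcontS : ContinuousOn (fun τ => G * Real.sqrt (f j (a + τ))) (Icc 0 S) :=
        continuousOn_const.mul (Real.continuous_sqrt.comp_continuousOn (hfca j a ha S))
      have hintS : IntegrableOn (fun τ => G * Real.sqrt (f j (a + τ))) (Ioo 0 S) volume :=
        (hcontS.integrableOn_compact isCompact_Icc).mono_set Ioo_subset_Icc_self
      -- compare the integrands on `(0, s)`
      have h1 : ∫ τ in Ioo (0 : ℝ) s, Real.sqrt (∫ x,
          (⟪v j (a + τ) x, FunctionSpaces.Torus.gradient h x⟫_ℝ) ^ 2) ≤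
          ∫ τ in Ioo (0 : ℝ) s, G * Real.sqrt (f j (a + τ)) := by
        refine integral_mono_of_nonneg (Eventually.of_forall fun τ => Real.sqrt_nonneg _)
          (hintS.mono_set (Ioo_subset_Ioo_right hs.2.le)) ?_
        filter_upwards [ae_restrict_mem measurableSet_Ioo] with τ hτ
        exact sqrt_integral_inner_gradient_sq_le (hvL2 j (a + τ) (by linarith [hτ.1])) hG
      -- enlarge the window to `(0, S)`
      have h2 : ∫ τ in Ioo (0 : ℝ) s, G * Real.sqrt (f j (a + τ)) ≤
          ∫ τ in Ioo (0 : ℝ) S, G * Real.sqrt (f j (a + τ)) :=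
        setIntegral_mono_set hintS
          (Eventually.of_forall fun τ => mul_nonneg hG0 (Real.sqrt_nonneg _))
          (Ioo_subset_Ioo_right hs.2.le).eventuallyLE
      -- Cauchy–Schwarz in time
      have h3 : (∫ τ in Ioo (0 : ℝ) S, Real.sqrt (f j (a + τ))) ^ 2 ≤
          S * ∫ τ in Ioo 0 S, f j (a + τ) :=
        sq_setIntegral_sqrt_le hS0.le (hfca j a ha S) fun τ _ => hf0 j (a + τ)
      have h0 : 0 ≤ ∫ τ in Ioo (0 : ℝ) s, Real.sqrt (∫ x,
          (⟪v j (a + τ) x, FunctionSpaces.Torus.gradient h x⟫_ℝ) ^ 2) :=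
        integral_nonneg fun τ => Real.sqrt_nonneg _
      have h4 := h1.trans h2
      rw [integral_const_mul] at h4
      calc (∫ τ in Ioo (0 : ℝ) s, Real.sqrt (∫ x,
            (⟪v j (a + τ) x, FunctionSpaces.Torus.gradient h x⟫_ℝ) ^ 2)) ^ 2
          ≤ (G * ∫ τ in Ioo (0 : ℝ) S, Real.sqrt (f j (a + τ))) ^ 2 := pow_le_pow_left₀ h0 h4 2
        _ = G ^ 2 * (∫ τ in Ioo (0 : ℝ) S, Real.sqrt (f j (a + τ))) ^ 2 := by ring
        _ ≤ G ^ 2 * (S * ∫ τ in Ioo 0 S, f j (a + τ)) := by gcongr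
        _ = G ^ 2 * S * ∫ τ in Ioo 0 S, f j (a + τ) := by ring
    -- assemble
    have hI0 : 0 ≤ ∫ τ in Ioo 0 S, f j (a + τ) :=
      setIntegral_nonneg measurableSet_Ioo fun τ _ => hf0 j (a + τ)
    have hdiff : 2 * ν j * s * Real.sqrt L * Dh ≤ 3 * ν j * s₀ * Real.sqrt L * Dh := by
      have hsS : s ≤ S := hs.2.le
      have hK0 : 0 ≤ ν j * Real.sqrt L * Dh := mul_nonneg (mul_nonneg (hν j).le (Real.sqrt_nonneg _)) hDh0
      have h23 : 2 * s ≤ 3 * s₀ := by rw [hSdef] at hsS; linarith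
      calc 2 * ν j * s * Real.sqrt L * Dh = (2 * s) * (ν j * Real.sqrt L * Dh) := by ring
        _ ≤ (3 * s₀) * (ν j * Real.sqrt L * Dh) := mul_le_mul_of_nonneg_right h23 hK0
        _ = 3 * ν j * s₀ * Real.sqrt L * Dh := by ring
    rw [hSdef] at hvel
    linarith [hbal, hCS, hvel, hdiff]
  /- Step B: integrate Step A over the phases `a ∈ (0, R)`, `R → ∞`:
     `7L/8 ≤ 3 ν_j s₀ √L Dh + 5 G² s₀² E`. -/
  have stepB : ∀ j, 7 * L / 8 ≤ 3 * ν j * s₀ * Real.sqrt L * Dh + 5 * G ^ 2 * s₀ ^ 2 * E := by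
    intro j
    obtain ⟨T₀, hT₀⟩ := eventually_atTop.1 (hEmean j)
    set R : ℝ := max T₀ (9 * S) + 1 with hRdef
    have hR9 : 9 * S ≤ R := by rw [hRdef]; linarith [le_max_right T₀ (9 * S)]
    have hR0 : 0 < R := by linarith
    have hRT : T₀ ≤ R + S := by rw [hRdef]; linarith [le_max_left T₀ (9 * S)]
    -- the window form of Step A
    have hAW : ∀ t ∈ Icc S (R + S),
        7 * L / 8 ≤ 3 * ν j * s₀ * Real.sqrt L * Dh + 3 * G ^ 2 * s₀ * ∫ τ in (t - S)..t, f j τ := by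
      intro t ht
      have hta : 0 ≤ t - S := by linarith [ht.1]
      have hA := stepA j (t - S) hta
      have e : ∫ τ in Ioo 0 S, f j (t - S + τ) = ∫ τ in (t - S)..t, f j τ := by
        rw [← integral_Ioc_eq_integral_Ioo, ← intervalIntegral.integral_of_le hS0.le,
          intervalIntegral.integral_comp_add_left (f j) (t - S), add_zero, sub_add_cancel]
      rw [e] at hA
      exact hA
    -- integrate over `t ∈ [S, R + S]`
    have hWint : IntervalIntegrable (fun t => ∫ τ in (t - S)..t, f j τ) volume S (R + S) :=
      AgeDecoupling.intervalIntegrable_window (hfi j) hS0.le (by linarith)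
    have hmono := intervalIntegral.integral_mono_on (μ := volume) (a := S) (b := R + S)
      (f := fun _ => 7 * L / 8)
      (g := fun t => 3 * ν j * s₀ * Real.sqrt L * Dh + 3 * G ^ 2 * s₀ * ∫ τ in (t - S)..t, f j τ)
      (by linarith) intervalIntegrable_const (intervalIntegrable_const.add (hWint.const_mul _)) hAW
    have eL : ∫ _ in S..(R + S), (7 * L / 8 : ℝ) = R * (7 * L / 8) := by
      rw [intervalIntegral.integral_const, smul_eq_mul]; ring
    have eR : ∫ t in S..(R + S),
        (3 * ν j * s₀ * Real.sqrt L * Dh + 3 * G ^ 2 * s₀ * ∫ τ in (t - S)..t, f j τ) =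
        R * (3 * ν j * s₀ * Real.sqrt L * Dh) +
          3 * G ^ 2 * s₀ * ∫ t in S..(R + S), ∫ τ in (t - S)..t, f j τ := by
      rw [intervalIntegral.integral_add intervalIntegrable_const (hWint.const_mul _),
        intervalIntegral.integral_const, intervalIntegral.integral_const_mul, smul_eq_mul]
      ring
    rw [eL, eR] at hmono
    -- sliding windows: `∫_S^{R+S} W ≤ S ∫₀^{R+S} f_j ≤ S (R+S) E`
    have hwin : ∫ t in S..(R + S), (∫ τ in (t - S)..t, f j τ) ≤ S * ∫ τ in (0 : ℝ)..(R + S), f j τ :=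
      AgeDecoupling.integral_window_le (hfi j) (hf0 j) hS0.le (by linarith)
    have hmean : ∫ τ in (0 : ℝ)..(R + S), f j τ ≤ (R + S) * E := by
      have h1 := hT₀ (R + S) hRT
      have hRS0 : 0 < R + S := by linarith
      unfold timeMean at h1
      rw [inv_mul_le_iff₀ hRS0] at h1
      exact h1
    have hGs : 0 ≤ 3 * G ^ 2 * s₀ := by positivity
    have h1 : R * (7 * L / 8) ≤ R * (3 * ν j * s₀ * Real.sqrt L * Dh) +
        3 * G ^ 2 * s₀ * (S * ((R + S) * E)) := by
      have := mul_le_mul_of_nonneg_left (hwin.trans (mul_le_mul_of_nonneg_left hmean hS0.le)) hGs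
      linarith
    -- `3 S (R + S) ≤ 5 s₀ R` since `R ≥ 9 S`, `S = 3 s₀ / 2`
    have h2 : 3 * G ^ 2 * s₀ * (S * ((R + S) * E)) ≤ R * (5 * G ^ 2 * s₀ ^ 2 * E) := by
      have hSR : 3 * S * (R + S) ≤ 5 * s₀ * R := by rw [hSdef] at hR9 ⊢; nlinarith
      have hGE : 0 ≤ G ^ 2 * E := mul_nonneg (sq_nonneg G) hE0
      nlinarith [mul_le_mul_of_nonneg_left hSR (mul_nonneg hGE hs₀.le)]
    have h3 : R * (7 * L / 8) ≤ R * (3 * ν j * s₀ * Real.sqrt L * Dh + 5 * G ^ 2 * s₀ ^ 2 * E) := by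
      linarith
    exact le_of_mul_le_mul_left h3 hR0
  /- Step C: `5 G² s₀² E = 180 C^{1/3} G² E / γ²`, and `ν_j → 0`. -/
  by_contra hlt
  push Not at hlt
  have h5 : 5 * G ^ 2 * s₀ ^ 2 * E < 7 * L / 8 := by
    have e : 5 * G ^ 2 * s₀ ^ 2 * E * γ ^ 2 = 180 * (y ^ 2 * G ^ 2 * E) := by
      have : s₀ * γ = 6 * y := by rw [mul_comm]; exact hγs₀
      calc 5 * G ^ 2 * s₀ ^ 2 * E * γ ^ 2 = 5 * G ^ 2 * E * (s₀ * γ) ^ 2 := by ring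
        _ = 180 * (y ^ 2 * G ^ 2 * E) := by rw [this]; ring
    have hlt' : 1440 * y ^ 2 * G ^ 2 * E < 7 * γ ^ 2 * L := by rw [hy2]; exact hlt
    have hγ2 : 0 < γ ^ 2 := by positivity
    have key : 5 * G ^ 2 * s₀ ^ 2 * E * γ ^ 2 < 7 * L / 8 * γ ^ 2 := by
      rw [e]; linarith
    exact lt_of_mul_lt_mul_right key hγ2.le
  have hK0 : 0 < 3 * s₀ * Real.sqrt L * Dh + 1 := by positivity
  have hε : 0 < 7 * L / 8 - 5 * G ^ 2 * s₀ ^ 2 * E := by linarith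
  have hb : 0 < (7 * L / 8 - 5 * G ^ 2 * s₀ ^ 2 * E) / (3 * s₀ * Real.sqrt L * Dh + 1) := by positivity
  obtain ⟨j, hj⟩ := (hνlim.eventually (Iio_mem_nhds hb)).exists
  have hj' : ν j * (3 * s₀ * Real.sqrt L * Dh + 1) < 7 * L / 8 - 5 * G ^ 2 * s₀ ^ 2 * E := by
    have := (lt_div_iff₀ hK0).1
      (show ν j < (7 * L / 8 - 5 * G ^ 2 * s₀ ^ 2 * E) / (3 * s₀ * Real.sqrt L * Dh + 1) from hj)
    linarith
  have hB' := stepB j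
  have hν0 : 0 < ν j := hν j
  have e3 : 3 * ν j * s₀ * Real.sqrt L * Dh = ν j * (3 * s₀ * Real.sqrt L * Dh + 1) - ν j := by ring
  rw [e3] at hB'
  linarith

/-- **The FAST relaxing-family class of line `SketchIdeator1` is EMPTY (unconditional).** The negated
statement is VERBATIM the hypothesis `hfast` of the lead's `stub_fastFloorUpgrade` (= the conclusion of
`stub_boost`) in `Cruxes/FloorUpgrade/Lines/SketchIdeator1.lean`: by `energy_floor` a relaxing family has
`7 γ² ‖h‖² ≤ 1440 C^{1/3} G² E`, while FAST asks `256 C^{1/3} G² E ≤ γ² ‖h‖²`. Hence `stub_fastFloorUpgrade`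
is vacuous and `stub_boost` is equivalent to `¬ RelaxingFamily` (crux r3). [folklore] -/
theorem fastRelaxingFamily_false : ¬
  ∃ (g : UnitAddTorus (Fin 2) → EuclideanSpace ℝ (Fin 2)) (h : UnitAddTorus (Fin 2) → ℝ),
      Literature.Analysis.FunctionSpaces.Torus.IsSmooth g ∧
      Literature.Analysis.FunctionSpaces.Torus.IsDivFree g ∧
      Literature.Analysis.FunctionSpaces.Torus.HasZeroMean g ∧
      Literature.Analysis.FunctionSpaces.Torus.IsSmooth h ∧
      Literature.Analysis.FunctionSpaces.Torus.HasZeroMean h ∧ h ≠ 0 ∧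
      ∃ (ν : ℕ → ℝ) (v₀ : ℕ → UnitAddTorus (Fin 2) → EuclideanSpace ℝ (Fin 2))
        (v : ℕ → ℝ → UnitAddTorus (Fin 2) → EuclideanSpace ℝ (Fin 2)),
        (∀ j, 0 < ν j) ∧ Filter.Tendsto ν Filter.atTop (nhds 0) ∧
        (∀ j, Literature.Analysis.FluidPDE.Torus.IsGlobalLerayHopf (ν j) (fun _ => g) (v₀ j) (v j)) ∧
        (∀ j : ℕ, ∀ (T : ℝ), 0 < T → MeasureTheory.MemLp
          (Literature.Analysis.FunctionSpaces.Torus.stLift (v j)) ⊤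
          (MeasureTheory.volume.restrict (Set.Ioo (0 : ℝ) T ×ˢ Set.univ))) ∧
        (∀ j, Literature.Analysis.FunctionSpaces.Torus.IsSmoothSpaceTimeOn (Set.Ici (0 : ℝ)) (v j)) ∧
        ∃ E C γ G : ℝ, (∀ j, Literature.Analysis.FluidPDE.meanEnergy (v j) ≤ E) ∧
          (∀ j, ∀ᶠ T in Filter.atTop,
            Literature.Analysis.FluidPDE.timeMean (fun t => ∫ x, ‖v j t x‖ ^ 2) T ≤ E) ∧
          1 ≤ C ∧ 0 < γ ∧
          (∀ x, ‖Literature.Analysis.FunctionSpaces.Torus.gradient h x‖ ≤ G) ∧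
          256 * C ^ ((1 : ℝ) / 3) * G ^ 2 * E ≤
            γ ^ 2 * Literature.Analysis.FluidPDE.Torus.scalarL2Sq h ∧
          ∀ (j : ℕ) (s : ℝ), 0 ≤ s → ∀ (T : ℝ) (θ : ℝ → UnitAddTorus (Fin 2) → ℝ),
            Literature.Analysis.FluidPDE.Torus.IsWeakScalarTransportOn T (ν j)
              (fun t => v j (s + t)) h θ →
            ∀ᵐ t ∂(MeasureTheory.volume.restrict (Set.Ioo (0 : ℝ) T)),
              Literature.Analysis.FluidPDE.Torus.scalarL2Sq (θ t) ≤
                C * Real.exp (-(γ * t)) * Literature.Analysis.FluidPDE.Torus.scalarL2Sq h := by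
  rintro ⟨g, h, -, -, -, hh, -, hh0, ν, v₀, v, hν, hνlim, hLH, hbd, hsm, E, C, γ, G, -, hEmean,
    hC1, hγ, hG, hfast, hU⟩
  have hL : 0 < scalarL2Sq h := scalarL2Sq_pos_of_ne_zero hh hh0
  have hfloor := energy_floor hh hh0 hν hνlim hLH hbd hsm hEmean hC1 hγ hG hU
  nlinarith [mul_pos (pow_pos hγ 2) hL]

end Summit.AnomalousDissipation.AnomalousDissipation.Theorems.FloorUpgrade.Negative

end
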